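import Mathlib
import HarnessLib
import Summits.PneNP.PneNP.Theorems.RamseyUncertifiablePaleySosRungSmallBiasCodegreesAux1
import Summits.PneNP.PneNP.Theorems.RamseyUncertifiablePaleySosRungSmallBiasCodegreesAux2

/-!
# Route RamseyUncertifiable, crux `PaleySosRung` (stmt-PneNP-9817), line `weil-patch-transfer`:
# stub (P) `stub_smallBiasCodegrees` — small bias ⇒ star-codegree concentration

The registered probabilistic stub of the lead's skeleton: for every `r` there are `k, m₀` such
that for every finite family `H : ι → SimpleGraph (Fin m)`, `m ≥ m₀`, which is `k`-wise
`m^{-k}`-biased (every nonempty signed pattern of `≤ k` ordered edges has family sum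
`≤ |ι| / m^k` in absolute value), outside an exceptional set `B` with `3|B| ≤ |ι|` every `H i`
has ALL star codegrees `Σ_{w ∉ A ∪ A'} τ(A,w) τ(A',w)` (`τ(A,w) = 2^{|A|}·1[A ⊆ N(w)] − 1`,
`|A| = |A'| = a ≤ r`, `A ≠ A'`) within `m^{9/16}` of `(2^{|A ∩ A'|} − 1)(m − |A ∪ A'|)`.

Proof (assembled from the two helper files):
* `…SmallBiasCodegreesAux1` (`codeg_deviation_le`): the deviation is at most
  `2^a·2^a·λ` as soon as every star sum `S_Q = Σ_{w ∉ A∪A'} Π_{x∈Q} s(x,w)`, `∅ ≠ Q ⊆ A ∪ A'`,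
  has `|S_Q| ≤ λ`;
* `…SmallBiasCodegreesAux2` (`sbc_badCount`): with `n = 2h`, `h = 32r + 16 = 16(2r+1)`,
  `k = (2r+1)n` and the threshold `λ = m^{17/32}` (so `λ^n = m^{17(2r+1)} = m^h·m^{2r+1}`),
  the indices `i` with `|S_{Q,i}| > λ` number at most `|ι|(h^n + 1)/m^{2r+1}` for each `(Q, A∪A')`;
* union bound over `a ≤ r`, `A, A'` (`≤ m^r` each), `Q` (`≤ 4^r`): `|B|·m ≤ c_r |ι|` with
  `c_r = (r+1) 4^r (h^n+1)`, so `3|B| ≤ |ι|` for `m ≥ 3c_r`; and `4^a λ ≤ 4^r m^{17/32} ≤ m^{9/16}`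
  for `m ≥ 4^{32r}`. Hence `m₀ = max (4^{32r}) (3 c_r)`.
[folklore; Füredi–Komlós 1981 (even-sequence count); arXiv:1503.06447 §9 (style)]
-/

set_option linter.dupNamespace false -- `Summit.PneNP.PneNP.…`: summit = sub-problem (D-0017)

namespace Summit.PneNP.PneNP.Theorems.PaleySosRungWeilPatch

open Finset

/-- Exponent bookkeeping: `(m^{17/32})^{32c} = m^{17c}`. -/
theorem rpow_threshold_pow (m c : ℕ) :
    ((m : ℝ) ^ ((17 : ℝ) / 32)) ^ (32 * c) = (m : ℝ) ^ (17 * c) := by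
  rw [← Real.rpow_mul_natCast (Nat.cast_nonneg m), ← Real.rpow_natCast _ (17 * c)]
  congr 1
  push_cast
  ring

/-- Exponent bookkeeping: `4^r · m^{17/32} ≤ m^{9/16}` once `4^{32r} ≤ m`. -/
theorem four_pow_mul_rpow_le (r m : ℕ) (hm : 4 ^ (32 * r) ≤ m) :
    (4 : ℝ) ^ r * (m : ℝ) ^ ((17 : ℝ) / 32) ≤ (m : ℝ) ^ ((9 : ℝ) / 16) := by
  have hm0 : (0 : ℝ) ≤ (m : ℝ) := Nat.cast_nonneg m
  have h4 : (4 : ℝ) ^ r ≤ (m : ℝ) ^ ((1 : ℝ) / 32) := by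
    have h1 : (4 : ℝ) ^ r = (((4 : ℝ) ^ r) ^ 32) ^ ((32 : ℕ) : ℝ)⁻¹ :=
      (Real.pow_rpow_inv_natCast (by positivity) (by norm_num)).symm
    rw [h1, show ((1 : ℝ) / 32) = ((32 : ℕ) : ℝ)⁻¹ by norm_num]
    refine Real.rpow_le_rpow (by positivity) ?_ (by positivity)
    rw [← pow_mul, mul_comm]
    exact_mod_cast hm
  calc (4 : ℝ) ^ r * (m : ℝ) ^ ((17 : ℝ) / 32)
      ≤ (m : ℝ) ^ ((1 : ℝ) / 32) * (m : ℝ) ^ ((17 : ℝ) / 32) :=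
        mul_le_mul_of_nonneg_right h4 (Real.rpow_nonneg hm0 _)
    _ = (m : ℝ) ^ ((9 : ℝ) / 16) := by
        rw [← Real.rpow_add' hm0 (by norm_num)]
        norm_num

/-- **(P) Small bias ⇒ codegree concentration for two thirds of the samples** (the registered
stub `stub_smallBiasCodegrees` of line `weil-patch-transfer`, crux `PaleySosRung`). For `r` there
are `k, m₀` such that for every `k`-wise `m^{-k}`-biased finite family
`H : ι → SimpleGraph (Fin m)`, `m ≥ m₀`, outside an exceptional set `B` with `3|B| ≤ |ι|` every
`H i` has all star codegrees of pairs of distinct `a`-sets, `1 ≤ a ≤ r`, within `m^{9/16}` of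
`(2^{|A∩A'|} − 1)(m − |A ∪ A'|)`.
Constants: `h = 32r+16`, `n = 2h`, `k = (2r+1)n`, `m₀ = max (4^{32r}) (3(r+1)4^r(h^n+1))`.
[folklore; Füredi–Komlós 1981] -/
theorem stub_smallBiasCodegrees :
    ∀ r : ℕ, ∃ k : ℕ, ∃ m₀ : ℕ, ∀ m ≥ m₀,
      ∀ (ι : Type*) [Fintype ι] (H : ι → SimpleGraph (Fin m)) [∀ i, DecidableRel (H i).Adj],
        (∀ E : Finset (Fin m × Fin m), E.Nonempty → E.card ≤ k → (∀ e ∈ E, e.1 < e.2) →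
          |∑ i, ∏ e ∈ E, (if (H i).Adj e.1 e.2 then (1 : ℝ) else -1)|
            ≤ (Fintype.card ι : ℝ) / (m : ℝ) ^ k) →
        ∃ B : Finset ι, 3 * B.card ≤ Fintype.card ι ∧ ∀ i, i ∉ B →
          ∀ a : ℕ, 1 ≤ a → a ≤ r → ∀ A A' : Finset (Fin m), A.card = a → A'.card = a → A ≠ A' →
            |(∑ w ∈ (Finset.univ \ (A ∪ A')),
                (if ∀ x ∈ A, (H i).Adj x w then (2 : ℝ) ^ a - 1 else -1) *
                (if ∀ x ∈ A', (H i).Adj x w then (2 : ℝ) ^ a - 1 else -1))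
              - ((2 : ℝ) ^ (A ∩ A').card - 1) * ((m : ℝ) - ((A ∪ A').card : ℝ))|
              ≤ (m : ℝ) ^ ((9 : ℝ) / 16) := by
  intro r
  -- constants
  set h : ℕ := 32 * r + 16 with hh
  set n : ℕ := 2 * h with hn
  set k : ℕ := (2 * r + 1) * n with hk
  set c : ℕ := (r + 1) * 4 ^ r * (h ^ n + 1) with hc
  refine ⟨k, max (4 ^ (32 * r)) (3 * c), ?_⟩
  intro m hm ι _ H _ hbias
  have hm4 : 4 ^ (32 * r) ≤ m := le_of_max_le_left hm
  have hmc : 3 * c ≤ m := le_of_max_le_right hm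
  have hm1 : 1 ≤ m := le_trans (Nat.one_le_pow _ _ (by norm_num)) hm4
  have hm0 : (0 : ℝ) < (m : ℝ) := by exact_mod_cast hm1
  have hn32 : n = 32 * (2 * r + 1) := by rw [hn, hh]; ring
  have hnk : n ≤ k := by rw [hk]; exact Nat.le_mul_of_pos_left n (by omega)
  classical
  -- threshold, star sums and bad sets
  set θ : ℝ := (m : ℝ) ^ ((17 : ℝ) / 32) with hθ
  have hθ0 : 0 ≤ θ := Real.rpow_nonneg hm0.le _
  have hθn : θ ^ n = (m : ℝ) ^ h * (m : ℝ) ^ (2 * r + 1) := by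
    have he : 17 * (2 * r + 1) = h + (2 * r + 1) := by rw [hh]; ring
    rw [hθ, hn32, rpow_threshold_pow, ← pow_add, he]
  set S : ι → Finset (Fin m) → Finset (Fin m) → ℝ := fun i Q V =>
    ∑ w ∈ univ \ V, ∏ x ∈ Q, (if (H i).Adj x w then (1 : ℝ) else -1) with hS
  set bad : Finset (Fin m) → Finset (Fin m) → Finset ι := fun Q V =>
    univ.filter fun i => θ < |S i Q V| with hbad_def
  -- per-(Q, V) count of bad indices
  have hbad : ∀ Q V : Finset (Fin m), Q ⊆ V → Q.Nonempty → Q.card ≤ 2 * r →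
      (bad Q V).card * m ^ (2 * r + 1) ≤ Fintype.card ι * (h ^ n + 1) := by
    intro Q V hQV hQ hQr
    have hQk : Q.card * n ≤ k := by rw [hk]; exact Nat.mul_le_mul_right n (by omega)
    have key := sbc_badCount H k n h rfl hnk hm1 hbias Q V hQV hQ hQk θ hθ0 (bad Q V)
      (fun i hi => by
        have hi' := (mem_filter.1 hi).2
        exact hi'.le)
    rw [hθn] at key
    have hmh : (1 : ℝ) ≤ (m : ℝ) ^ h := one_le_pow₀ (by exact_mod_cast hm1)
    have hmhpos : (0 : ℝ) < (m : ℝ) ^ h := by positivity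
    have hcι : (0 : ℝ) ≤ (Fintype.card ι : ℝ) := Nat.cast_nonneg _
    have key2 : ((bad Q V).card : ℝ) * (m : ℝ) ^ (2 * r + 1) * (m : ℝ) ^ h ≤
        (Fintype.card ι : ℝ) * ((h : ℝ) ^ n + 1) * (m : ℝ) ^ h := by
      calc ((bad Q V).card : ℝ) * (m : ℝ) ^ (2 * r + 1) * (m : ℝ) ^ h
          = ((bad Q V).card : ℝ) * ((m : ℝ) ^ h * (m : ℝ) ^ (2 * r + 1)) := by ring
        _ ≤ (Fintype.card ι : ℝ) * ((h : ℝ) ^ n * (m : ℝ) ^ h + 1) := key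
        _ ≤ (Fintype.card ι : ℝ) * ((h : ℝ) ^ n * (m : ℝ) ^ h + (m : ℝ) ^ h) := by gcongr
        _ = (Fintype.card ι : ℝ) * ((h : ℝ) ^ n + 1) * (m : ℝ) ^ h := by ring
    have key3 := le_of_mul_le_mul_right key2 hmhpos
    exact_mod_cast key3
  -- the exceptional set
  set B : Finset ι := (range (r + 1)).biUnion fun a => (powersetCard a univ).biUnion fun A =>
    (powersetCard a univ).biUnion fun A' =>
      ((A ∪ A').powerset.erase ∅).biUnion fun Q => bad Q (A ∪ A') with hB_def
  refine ⟨B, ?_, ?_⟩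
  · -- `3 |B| ≤ |ι|` by the union bound
    have h1 : B.card ≤ ∑ a ∈ range (r + 1), ∑ A ∈ powersetCard a univ,
        ∑ A' ∈ powersetCard a univ,
          ∑ Q ∈ (A ∪ A').powerset.erase ∅, (bad Q (A ∪ A')).card := by
      refine card_biUnion_le.trans (sum_le_sum fun a _ => ?_)
      refine card_biUnion_le.trans (sum_le_sum fun A _ => ?_)
      refine card_biUnion_le.trans (sum_le_sum fun A' _ => ?_)
      exact card_biUnion_le
    have h2 : ∀ a ∈ range (r + 1), ∀ A ∈ powersetCard a (univ : Finset (Fin m)),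
        ∀ A' ∈ powersetCard a (univ : Finset (Fin m)),
          ∑ Q ∈ (A ∪ A').powerset.erase ∅, (bad Q (A ∪ A')).card * m ^ (2 * r + 1) ≤
            4 ^ r * (Fintype.card ι * (h ^ n + 1)) := by
      intro a ha A hA A' hA'
      have har : a ≤ r := Nat.lt_succ_iff.1 (mem_range.1 ha)
      have hAc : A.card = a := (mem_powersetCard.1 hA).2
      have hA'c : A'.card = a := (mem_powersetCard.1 hA').2
      have hUc : (A ∪ A').card ≤ 2 * r := (card_union_le A A').trans (by omega)
      calc ∑ Q ∈ (A ∪ A').powerset.erase ∅, (bad Q (A ∪ A')).card * m ^ (2 * r + 1)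
          ≤ ∑ Q ∈ (A ∪ A').powerset.erase ∅, Fintype.card ι * (h ^ n + 1) :=
            sum_le_sum fun Q hQ => hbad Q (A ∪ A') (mem_powerset.1 (mem_of_mem_erase hQ))
              (nonempty_iff_ne_empty.2 (ne_of_mem_erase hQ))
              ((card_le_card (mem_powerset.1 (mem_of_mem_erase hQ))).trans hUc)
        _ = ((A ∪ A').powerset.erase ∅).card * (Fintype.card ι * (h ^ n + 1)) := by
            rw [sum_const, smul_eq_mul]
        _ ≤ 4 ^ r * (Fintype.card ι * (h ^ n + 1)) := by
            refine Nat.mul_le_mul_right _ ?_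
            calc ((A ∪ A').powerset.erase ∅).card ≤ (A ∪ A').powerset.card := card_erase_le
              _ = 2 ^ (A ∪ A').card := card_powerset _
              _ ≤ 2 ^ (2 * r) := Nat.pow_le_pow_right (by norm_num) hUc
              _ = 4 ^ r := by rw [pow_mul]; norm_num
    have h3 : ∀ a ∈ range (r + 1), (powersetCard a (univ : Finset (Fin m))).card ≤ m ^ r := by
      intro a ha
      have har : a ≤ r := Nat.lt_succ_iff.1 (mem_range.1 ha)
      rw [card_powersetCard, card_univ, Fintype.card_fin]
      exact (Nat.choose_le_pow m a).trans (Nat.pow_le_pow_right hm1 har)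
    have hB : B.card * m ^ (2 * r + 1) ≤ c * Fintype.card ι * m ^ (2 * r) := by
      calc B.card * m ^ (2 * r + 1)
          ≤ (∑ a ∈ range (r + 1), ∑ A ∈ powersetCard a univ, ∑ A' ∈ powersetCard a univ,
              ∑ Q ∈ (A ∪ A').powerset.erase ∅, (bad Q (A ∪ A')).card) * m ^ (2 * r + 1) :=
            Nat.mul_le_mul_right _ h1
        _ = ∑ a ∈ range (r + 1), ∑ A ∈ powersetCard a univ, ∑ A' ∈ powersetCard a univ,
              ∑ Q ∈ (A ∪ A').powerset.erase ∅, (bad Q (A ∪ A')).card * m ^ (2 * r + 1) := by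
            simp_rw [sum_mul]
        _ ≤ ∑ a ∈ range (r + 1), ∑ A ∈ powersetCard a (univ : Finset (Fin m)),
              ∑ A' ∈ powersetCard a (univ : Finset (Fin m)),
                4 ^ r * (Fintype.card ι * (h ^ n + 1)) :=
            sum_le_sum fun a ha => sum_le_sum fun A hA => sum_le_sum fun A' hA' =>
              h2 a ha A hA A' hA'
        _ = ∑ a ∈ range (r + 1), (powersetCard a (univ : Finset (Fin m))).card *
              ((powersetCard a (univ : Finset (Fin m))).card *
                (4 ^ r * (Fintype.card ι * (h ^ n + 1)))) := by
            simp_rw [sum_const, smul_eq_mul]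
        _ ≤ ∑ a ∈ range (r + 1), m ^ r * (m ^ r * (4 ^ r * (Fintype.card ι * (h ^ n + 1)))) :=
            sum_le_sum fun a ha => Nat.mul_le_mul (h3 a ha) (Nat.mul_le_mul_right _ (h3 a ha))
        _ = (r + 1) * (m ^ r * (m ^ r * (4 ^ r * (Fintype.card ι * (h ^ n + 1))))) := by
            rw [sum_const, card_range, smul_eq_mul]
        _ = c * Fintype.card ι * m ^ (2 * r) := by
            rw [hc]
            ring
    have hmpos : 0 < m ^ (2 * r) := by positivity
    have hB' : B.card * m ≤ c * Fintype.card ι := by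
      refine Nat.le_of_mul_le_mul_right ?_ hmpos
      calc B.card * m * m ^ (2 * r) = B.card * m ^ (2 * r + 1) := by ring
        _ ≤ c * Fintype.card ι * m ^ (2 * r) := hB
    refine Nat.le_of_mul_le_mul_right ?_ (show 0 < m by omega)
    calc 3 * B.card * m = 3 * (B.card * m) := by ring
      _ ≤ 3 * (c * Fintype.card ι) := Nat.mul_le_mul_left 3 hB'
      _ = 3 * c * Fintype.card ι := by ring
      _ ≤ m * Fintype.card ι := Nat.mul_le_mul_right _ hmc
      _ = Fintype.card ι * m := mul_comm _ _
  · -- outside `B` every star sum is `≤ θ`, so the deviation is `≤ 4^a θ ≤ m^{9/16}`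
    intro i hi a ha1 har A A' hA hA' _hAA'
    have hgood : ∀ Q : Finset (Fin m), Q ⊆ A ∪ A' → Q.Nonempty → |S i Q (A ∪ A')| ≤ θ := by
      intro Q hQ hQne
      by_contra hlt
      push Not at hlt
      apply hi
      exact mem_biUnion.2 ⟨a, mem_range.2 (by omega), mem_biUnion.2 ⟨A,
        mem_powersetCard.2 ⟨subset_univ _, hA⟩, mem_biUnion.2 ⟨A',
          mem_powersetCard.2 ⟨subset_univ _, hA'⟩, mem_biUnion.2 ⟨Q,
            mem_erase.2 ⟨hQne.ne_empty, mem_powerset.2 hQ⟩,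
              mem_filter.2 ⟨mem_univ _, hlt⟩⟩⟩⟩⟩
    have key := codeg_deviation_le (H i) A A' hθ0 hgood
    rw [hA, hA', Fintype.card_fin] at key
    refine key.trans ?_
    calc (2 : ℝ) ^ a * 2 ^ a * θ = (4 : ℝ) ^ a * θ := by
          rw [← mul_pow]
          norm_num
      _ ≤ (4 : ℝ) ^ r * θ := by gcongr; norm_num
      _ ≤ (m : ℝ) ^ ((9 : ℝ) / 16) := four_pow_mul_rpow_le r m hm4

end Summit.PneNP.PneNP.Theorems.PaleySosRungWeilPatch
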